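import Literature.MathematicalPhysics.QuantumFieldTheory.Balaban1983to89.B9Eq3101ConjugationLettersChain

/-!
# `Balaban1983to89.B9Eq3101ConjugationLettersCurl` — T. Bałaban, *Propagators for lattice gauge theories in a background field*, Commun. Math. Phys.
# **99** (1985) 389–434 [Balaban1985BackgroundPropagators] (3.49) p. 399, (3.101)–(3.103) p. 414 with (3.4) p. 391, (3.8) p. 392, (3.26) p. 395:
# **THE COMBES–THOMAS CONJUGATION LETTERS OF THE CURL `D_U` (3.4) (bonds → plaquettes) AND OF THE DIVERGENCE `D*_U` (3.8) (bonds → sites)** —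
# `‖e^{κχ}·curl(e^{−κχ}A) − curl A‖ ≤ 4‖c‖‖κ‖θ·M_T·d·‖A‖` and `‖e^{κχ}·D*(e^{−κχ}A) − D*A‖ ≤ 2‖c‖‖κ‖θ·M_T·√d·‖A‖` for EVERY transporter data bounded
# by `M_T`, every cutoff with bond increments `≤ θ` in the window `‖κ‖θ ≤ 1` (`η`-free readings at `c = η⁻¹`, `θ = ℓη`) — the two conjugation letters
# of the LOCAL PART `A₀ = D*_UD_U(curl) + D_UD*_U + Δ′ + aQ*Q` of (3.26) that the tree did not hold (the site-to-bond `D_U` letter is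
# `B9Eq3101ConjugationLetters` ∕ `…Chain`); stone (D0-a) of the NE9 owner's plan v11 («the `L²` block decay of `A₀⁻¹` by the route's Combes–Thomas
# substitute», `t4/b2b-balaban-t4-ne9-p1/g91/PLAN-V11-STOREY-G1.md` §2 (i) ∕ §3)

statement-level skeleton of published theorems with citation tags; proofs where landed; nothing here is a claim about the Yang–Mills mass gap

CITATION HEADER (lean-in-tree rule).  Audit cell `pub-balaban`, sub-cell `t4`, BINDER row NE9; filed by the NE9 BINDER-row OWNER lineage
`b2b-balaban-t4-ne9-p1` (gen 92).  Imports `B9Eq3101ConjugationLettersChain` (ne9-leaf-01: the `D_U` letter in abstract-map form, `eq_symm_of_pointwise`;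
through it `B9Eq3101ConjugationLetters`: the scalar lemmas `norm_exp_sub_one_le_of_abs_le`, `exp_mul_exp_neg_eq_one`, `exp_mul_exp_neg_eq_exp_sub`, and
`B9Eq310HessianOperator`: `covCurlL2K`, `PlaqL2K`).  Sources READ first-hand (`paper:balaban1985-cmp99-background-propagators`, journal page = PDF page +
388): p. 391 (3.4) *«(D_UA)(p) = … = (D_μA_ν)(x) − (D_νA_μ)(x)»*, p. 392 (3.8) *«(D*A)(x) = Σ_μ η⁻¹(R(U(x, x − ηe_μ))A(x − ηe_μ, x) − A(x, x + ηe_μ))»*,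
p. 399 (3.49) (exponential decay of the kernels), p. 414 (3.101)–(3.103) (print's own conjugation device inside the random walk), p. 395 (3.26).  Print proves
the decay by the random walk of Sect. C; the conjugation by `e^{κχ}` is the ROUTE's Combes–Thomas substitute (road B8″, `t4/ROUTES-NE9.md` §L1.2), as for
`G′(U)` in `B9Eq349ConjugatedGreenBlockDecay`; NOTHING of print's rate `δ₀` is asserted.

WHAT IS PROVED (sorry-free; proof lane — no `def`; [folklore] finite lattice calculus).  Transporters `R`, `S` are arbitrary `ℂ`-linear data with
`‖R(b)v‖ ≤ M_T‖v‖`; cutoff `χ` on SITES, read at the base point of a bond ∕ plaquette; weights `σ = e^{κχ}`, `ρ = e^{−κχ}`.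
* §1 CURL, function level: **`conj_covCurl_sub_apply`** (general weights with `σρ = 1`: the two `A(x,·)` terms cancel exactly,
  `σ(x)(curl(ρA))(p_{μν}(x)) − (curl A)(p) = c(σ(x)ρ(x+e_μ) − 1)R(x,μ)A(x+e_μ,ν) − c(σ(x)ρ(x+e_ν) − 1)R(x,ν)A(x+e_ν,μ)`), `conjExp_covCurl_sub_apply`,
  **`norm_conjExp_covCurl_sub_apply_le`** (`≤ 2‖c‖‖κ‖θM_T·(‖A(x+e_μ,ν)‖ + ‖A(x+e_ν,μ)‖)`), `sum_norm_sq_conjExp_covCurl_sub_le`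
  (`Σ_p ‖·‖² ≤ 4(2‖c‖‖κ‖θM_T)²·d²·Σ_b‖A(b)‖²`; counting helpers `sum_plaq_shift_fst_le`, `sum_plaq_shift_snd_le`, `card_dirPair_le`).
* §2 DIVERGENCE, function level: **`conj_covDiv_sub_apply`** (`σ(y)(D*(ρA))(y) − (D*A)(y) = c·Σ_μ (σ(y)ρ(y−e_μ) − 1)S(y−e_μ,μ)A(y−e_μ,μ)`),
  `norm_conjExp_covDiv_sub_apply_le` (`≤ 2‖c‖‖κ‖θM_T·Σ_μ‖A(y−e_μ,μ)‖`), `sum_norm_sq_conjExp_covDiv_sub_le` (`≤ (2‖c‖‖κ‖θM_T)²·d·Σ_b‖A(b)‖²`;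
  helper `sum_site_unshift_eq`).
* §3 `L²` level (uniform weight `c₀` on bonds, sites, plaquettes): **`norm_conjExp_covCurlL2K_sub_le`** (`≤ 4‖c‖‖κ‖θM_T·d·‖A‖`),
  **`norm_conjExp_covDivL2K_sub_le`** (`≤ 2‖c‖‖κ‖θM_T·√d·‖A‖`), and the ABSTRACT-MAP forms **`norm_mulOp_covCurlL2K_sub_le`**,
  **`norm_mulOp_covDivL2K_sub_le`** (maps `S_P`∕`S_S` and `S_B⁻¹` given by their pointwise action, as in `B9Eq3101ConjugationLettersChain`).
HONEST SCOPE.  Two (I4)-type letters; no Green's function, no window in `U`, no decay statement; the cocurl letter (plaquettes → bonds) is the adjoint of §1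
and is left to the instance file; nothing of [B9] Thm 3.1∕3.3∕3.11 asserted; «NE9 ⇐ the named binders»; NE9 NOT PRINTED ∕ NOT PROVED; row WALLED ON A MODEL
(O-NE9-1; #5 UNRULED); spine PROVED 0∕9; rung (B)+1 on a finite T⁴ — NOT infinite volume, NOT mass gap, NOT BetaPertH, NOT Clay.  HONEST DEPENDENCY: continuum
YM on T⁴ ⇐ BetaPertH ∧ nine spine estimates (0/9 proved); BetaPertH ⇐ (D1) ∧ (D4) ∧ CAP+tail.  NEW file; nothing modified.  Net new unproved facts: 0.
-/

noncomputable section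

open scoped BigOperators
open Finset

namespace Literature.MathematicalPhysics.QuantumFieldTheory.Balaban1983to89.B9Eq3101ConjugationLettersCurl

open B4Sect5Torus (TSite)
open B9SectCLatticeCarrier (Bond DirPair bpos btgt shift unshift shift_unshift unshift_shift)
open B9Eq33CovDerivVector (covDiv covDiv_apply shiftEquiv)
open B9Eq34CovCurlVector (covCurl covCurl_apply_coord)
open B9Eq311L2Pairing (WL2)
open B11Eq103H1Complex (SiteL2K BondL2K covDivL2K equiv_covDivL2K)
open B9Eq310HessianOperator (PlaqL2K covCurlL2K equiv_covCurlL2K)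
open B9Eq3101ConjugationLetters (norm_exp_sub_one_le_of_abs_le exp_mul_exp_neg_eq_one exp_mul_exp_neg_eq_exp_sub)
open B9Eq3101ConjugationLettersChain (eq_symm_of_pointwise)

/-! ## §1 The curl (3.4), function level -/

section Curl

variable {d : ℕ} {Pd : Fin d → ℕ} {V : Type*} [NormedAddCommGroup V] [NormedSpace ℂ V]

/-- **IDENTITY (general weights).** With `σ(x)ρ(x) = 1` the two untransported terms `A(x,ν)`, `A(x,μ)` of (3.4) cancel exactly:
`σ(x)·(curl(ρA))(p_{μν}(x)) − (curl A)(p_{μν}(x)) = c(σ(x)ρ(x+e_μ) − 1)·R(x,μ)A(x+e_μ,ν) − c(σ(x)ρ(x+e_ν) − 1)·R(x,ν)A(x+e_ν,μ)` — ANY scalar `c`, ANY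
`ℂ`-linear transporters (the weight `ρ` of a bond is read at its base point). [folklore] [cite: Balaban1985BackgroundPropagators, (3.4) p.391, (3.101)–(3.103) p.414] -/
theorem conj_covCurl_sub_apply {σ ρ : TSite d Pd → ℂ} (hσρ : ∀ x, σ x * ρ x = 1) (c : ℂ) (R : Bond d Pd → V →ₗ[ℂ] V) (A : Bond d Pd → V)
    (x : TSite d Pd) (q : DirPair d) :
    σ x • covCurl c R (fun b => ρ (bpos b) • A b) (x, q) - covCurl c R A (x, q) =
      (c * (σ x * ρ (shift q.1.1 x) - 1)) • R (x, q.1.1) (A (shift q.1.1 x, q.1.2)) -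
        (c * (σ x * ρ (shift q.1.2 x) - 1)) • R (x, q.1.2) (A (shift q.1.2 x, q.1.1)) := by
  have h1 := hσρ x
  simp only [covCurl_apply_coord, bpos, map_smul, smul_sub, smul_smul]
  match_scalars <;> first | ring1 | linear_combination c * h1 | linear_combination (-c) * h1

/-- **IDENTITY (exponential weights):** `(e^{κχ} curl e^{−κχ} − curl)A (p_{μν}(x)) = c(e^{κ(χ(x)−χ(x+e_μ))} − 1)R(x,μ)A(x+e_μ,ν) −
c(e^{κ(χ(x)−χ(x+e_ν))} − 1)R(x,ν)A(x+e_ν,μ)`. [folklore] [cite: Balaban1985BackgroundPropagators, (3.49) p.399, (3.101)–(3.103) p.414] -/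
theorem conjExp_covCurl_sub_apply (κ : ℂ) (χ : TSite d Pd → ℝ) (c : ℂ) (R : Bond d Pd → V →ₗ[ℂ] V) (A : Bond d Pd → V)
    (x : TSite d Pd) (q : DirPair d) :
    Complex.exp (κ * (χ x : ℂ)) • covCurl c R (fun b => Complex.exp (-(κ * (χ (bpos b) : ℂ))) • A b) (x, q) - covCurl c R A (x, q) =
      (c * (Complex.exp (κ * ((χ x - χ (shift q.1.1 x) : ℝ) : ℂ)) - 1)) • R (x, q.1.1) (A (shift q.1.1 x, q.1.2)) -
        (c * (Complex.exp (κ * ((χ x - χ (shift q.1.2 x) : ℝ) : ℂ)) - 1)) • R (x, q.1.2) (A (shift q.1.2 x, q.1.1)) := by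
  rw [conj_covCurl_sub_apply (exp_mul_exp_neg_eq_one κ χ) c R A x q, exp_mul_exp_neg_eq_exp_sub, exp_mul_exp_neg_eq_exp_sub]

/-- **POINTWISE BOUND.** With `|χ(b₋) − χ(b₊)| ≤ θ` on every bond, the window `‖κ‖θ ≤ 1` and transporters `‖R(b)v‖ ≤ M_T‖v‖`:
`‖(e^{κχ} curl e^{−κχ} − curl)A (p_{μν}(x))‖ ≤ 2‖c‖‖κ‖θ·M_T·(‖A(x+e_μ,ν)‖ + ‖A(x+e_ν,μ)‖)`. [folklore]
[cite: Balaban1985BackgroundPropagators, (3.49) p.399, (3.101)–(3.103) p.414] -/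
theorem norm_conjExp_covCurl_sub_apply_le {θ MT : ℝ} {R : Bond d Pd → V →ₗ[ℂ] V} (hR : ∀ b v, ‖R b v‖ ≤ MT * ‖v‖) {κ : ℂ}
    {χ : TSite d Pd → ℝ} (hχ : ∀ b : Bond d Pd, |χ (bpos b) - χ (btgt b)| ≤ θ) (hwin : ‖κ‖ * θ ≤ 1) (c : ℂ) (A : Bond d Pd → V)
    (x : TSite d Pd) (q : DirPair d) :
    ‖Complex.exp (κ * (χ x : ℂ)) • covCurl c R (fun b => Complex.exp (-(κ * (χ (bpos b) : ℂ))) • A b) (x, q) - covCurl c R A (x, q)‖ ≤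
      2 * ‖c‖ * ‖κ‖ * θ * MT * (‖A (shift q.1.1 x, q.1.2)‖ + ‖A (shift q.1.2 x, q.1.1)‖) := by
  rw [conjExp_covCurl_sub_apply]
  have e1 : ∀ μ ν : Fin d, ‖(c * (Complex.exp (κ * ((χ x - χ (shift μ x) : ℝ) : ℂ)) - 1)) • R (x, μ) (A (shift μ x, ν))‖ ≤
      2 * ‖c‖ * ‖κ‖ * θ * MT * ‖A (shift μ x, ν)‖ := fun μ ν => by
    rw [norm_smul, norm_mul]
    have h1 : ‖Complex.exp (κ * ((χ x - χ (shift μ x) : ℝ) : ℂ)) - 1‖ ≤ 2 * ‖κ‖ * θ := norm_exp_sub_one_le_of_abs_le (hχ (x, μ)) hwin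
    have h2 : ‖R (x, μ) (A (shift μ x, ν))‖ ≤ MT * ‖A (shift μ x, ν)‖ := hR _ _
    have h0 : 0 ≤ 2 * ‖κ‖ * θ := le_trans (norm_nonneg _) h1
    calc ‖c‖ * ‖Complex.exp (κ * ((χ x - χ (shift μ x) : ℝ) : ℂ)) - 1‖ * ‖R (x, μ) (A (shift μ x, ν))‖
        ≤ ‖c‖ * (2 * ‖κ‖ * θ) * (MT * ‖A (shift μ x, ν)‖) :=
          mul_le_mul (mul_le_mul_of_nonneg_left h1 (norm_nonneg c)) h2 (norm_nonneg _) (mul_nonneg (norm_nonneg c) h0)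
      _ = 2 * ‖c‖ * ‖κ‖ * θ * MT * ‖A (shift μ x, ν)‖ := by ring
  calc _ ≤ ‖(c * (Complex.exp (κ * ((χ x - χ (shift q.1.1 x) : ℝ) : ℂ)) - 1)) • R (x, q.1.1) (A (shift q.1.1 x, q.1.2))‖ +
        ‖(c * (Complex.exp (κ * ((χ x - χ (shift q.1.2 x) : ℝ) : ℂ)) - 1)) • R (x, q.1.2) (A (shift q.1.2 x, q.1.1))‖ := norm_sub_le _ _
    _ ≤ 2 * ‖c‖ * ‖κ‖ * θ * MT * ‖A (shift q.1.1 x, q.1.2)‖ + 2 * ‖c‖ * ‖κ‖ * θ * MT * ‖A (shift q.1.2 x, q.1.1)‖ :=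
        add_le_add (e1 _ _) (e1 _ _)
    _ = 2 * ‖c‖ * ‖κ‖ * θ * MT * (‖A (shift q.1.1 x, q.1.2)‖ + ‖A (shift q.1.2 x, q.1.1)‖) := by ring

/-- COUNTING: for each ordered pair `q = (μ,ν)`, `Σ_x g(x+e_μ, ν) ≤ Σ_b g(b)` for `g ≥ 0` (shift bijection + one slice of the bond sum), hence
`Σ_p g((ppos p)+e_{q₁}, q₂) ≤ |DirPair d|·Σ_b g(b)`. [folklore] [cite: Balaban1985BackgroundPropagators, (3.4) p.391] -/
theorem sum_plaq_shift_fst_le (g : Bond d Pd → ℝ) (hg : ∀ b, 0 ≤ g b) :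
    ∑ p : B9SectCLatticeCarrier.Plaq d Pd, g (shift p.2.1.1 p.1, p.2.1.2) ≤ Fintype.card (DirPair d) * ∑ b : Bond d Pd, g b := by
  -- both sides as iterated sums (the product types `Plaq = TSite × DirPair`, `Bond = TSite × Fin d`)
  rw [Fintype.sum_prod_type, Finset.sum_comm, Fintype.sum_prod_type]
  calc ∑ q : DirPair d, ∑ x : TSite d Pd, g (shift q.1.1 x, q.1.2) ≤ ∑ _q : DirPair d, ∑ y : TSite d Pd, ∑ ν : Fin d, g (y, ν) := by
        refine Finset.sum_le_sum fun q _ => ?_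
        rw [Fintype.sum_equiv (shiftEquiv q.1.1) (fun x => g (shift q.1.1 x, q.1.2)) (fun y => g (y, q.1.2)) (fun x => rfl)]
        exact Finset.sum_le_sum fun y _ => Finset.single_le_sum (f := fun ν => g (y, ν)) (fun ν _ => hg _) (Finset.mem_univ q.1.2)
    _ = Fintype.card (DirPair d) * ∑ y : TSite d Pd, ∑ ν : Fin d, g (y, ν) := by rw [Finset.sum_const, nsmul_eq_mul, Finset.card_univ]

/-- COUNTING, second slot: `Σ_p g((ppos p)+e_{q₂}, q₁) ≤ |DirPair d|·Σ_b g(b)` for `g ≥ 0`. [folklore] [cite: Balaban1985BackgroundPropagators, (3.4) p.391] -/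
theorem sum_plaq_shift_snd_le (g : Bond d Pd → ℝ) (hg : ∀ b, 0 ≤ g b) :
    ∑ p : B9SectCLatticeCarrier.Plaq d Pd, g (shift p.2.1.2 p.1, p.2.1.1) ≤ Fintype.card (DirPair d) * ∑ b : Bond d Pd, g b := by
  rw [Fintype.sum_prod_type, Finset.sum_comm, Fintype.sum_prod_type]
  calc ∑ q : DirPair d, ∑ x : TSite d Pd, g (shift q.1.2 x, q.1.1) ≤ ∑ _q : DirPair d, ∑ y : TSite d Pd, ∑ ν : Fin d, g (y, ν) := by
        refine Finset.sum_le_sum fun q _ => ?_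
        rw [Fintype.sum_equiv (shiftEquiv q.1.2) (fun x => g (shift q.1.2 x, q.1.1)) (fun y => g (y, q.1.1)) (fun x => rfl)]
        exact Finset.sum_le_sum fun y _ => Finset.single_le_sum (f := fun ν => g (y, ν)) (fun ν _ => hg _) (Finset.mem_univ q.1.1)
    _ = Fintype.card (DirPair d) * ∑ y : TSite d Pd, ∑ ν : Fin d, g (y, ν) := by rw [Finset.sum_const, nsmul_eq_mul, Finset.card_univ]

/-- `|DirPair d| ≤ d²` (the ordered direction pairs `μ < ν` indexing the plaquettes of (3.4) are a subtype of all pairs). [folklore]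
[cite: Balaban1985BackgroundPropagators, (3.4) p.391] -/
theorem card_dirPair_le : (Fintype.card (DirPair d) : ℝ) ≤ (d : ℝ) ^ 2 := by
  have h : Fintype.card (DirPair d) ≤ Fintype.card (Fin d × Fin d) := Fintype.card_subtype_le _
  rw [Fintype.card_prod, Fintype.card_fin] at h
  calc (Fintype.card (DirPair d) : ℝ) ≤ ((d * d : ℕ) : ℝ) := by exact_mod_cast h
    _ = (d : ℝ) ^ 2 := by push_cast; ring

/-- **`ℓ²` BOUND, function level:** `Σ_p ‖(e^{κχ} curl e^{−κχ} − curl)A (p)‖² ≤ 4·(2‖c‖‖κ‖θM_T)²·d²·Σ_b ‖A(b)‖²`. [folklore]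
[cite: Balaban1985BackgroundPropagators, (3.49) p.399, (3.101)–(3.103) p.414] -/
theorem sum_norm_sq_conjExp_covCurl_sub_le {θ MT : ℝ} {R : Bond d Pd → V →ₗ[ℂ] V} (hR : ∀ b v, ‖R b v‖ ≤ MT * ‖v‖) {κ : ℂ}
    {χ : TSite d Pd → ℝ} (hχ : ∀ b : Bond d Pd, |χ (bpos b) - χ (btgt b)| ≤ θ) (hwin : ‖κ‖ * θ ≤ 1) (c : ℂ) (A : Bond d Pd → V) :
    ∑ p : B9SectCLatticeCarrier.Plaq d Pd, ‖Complex.exp (κ * (χ p.1 : ℂ)) • covCurl c R (fun b => Complex.exp (-(κ * (χ (bpos b) : ℂ))) • A b) p -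
        covCurl c R A p‖ ^ 2 ≤ 4 * (2 * ‖c‖ * ‖κ‖ * θ * MT) ^ 2 * (d : ℝ) ^ 2 * ∑ b : Bond d Pd, ‖A b‖ ^ 2 := by
  set K : ℝ := 2 * ‖c‖ * ‖κ‖ * θ * MT with hK
  have hpt : ∀ p : B9SectCLatticeCarrier.Plaq d Pd, ‖Complex.exp (κ * (χ p.1 : ℂ)) • covCurl c R (fun b => Complex.exp (-(κ * (χ (bpos b) : ℂ))) • A b) p -
      covCurl c R A p‖ ^ 2 ≤ 2 * K ^ 2 * (‖A (shift p.2.1.1 p.1, p.2.1.2)‖ ^ 2 + ‖A (shift p.2.1.2 p.1, p.2.1.1)‖ ^ 2) := by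
    rintro ⟨x, q⟩
    have h := norm_conjExp_covCurl_sub_apply_le hR hχ hwin c A x q
    have hK0 : 0 ≤ K * (‖A (shift q.1.1 x, q.1.2)‖ + ‖A (shift q.1.2 x, q.1.1)‖) := (norm_nonneg _).trans h
    calc _ ≤ (K * (‖A (shift q.1.1 x, q.1.2)‖ + ‖A (shift q.1.2 x, q.1.1)‖)) ^ 2 := pow_le_pow_left₀ (norm_nonneg _) h 2
      _ ≤ 2 * K ^ 2 * (‖A (shift q.1.1 x, q.1.2)‖ ^ 2 + ‖A (shift q.1.2 x, q.1.1)‖ ^ 2) := by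
          nlinarith [sq_nonneg (‖A (shift q.1.1 x, q.1.2)‖ - ‖A (shift q.1.2 x, q.1.1)‖), sq_nonneg K]
  have hN := card_dirPair_le (d := d)
  have hS1 := sum_plaq_shift_fst_le (Pd := Pd) (fun b => ‖A b‖ ^ 2) (fun b => sq_nonneg _)
  have hS2 := sum_plaq_shift_snd_le (Pd := Pd) (fun b => ‖A b‖ ^ 2) (fun b => sq_nonneg _)
  have hsum0 : 0 ≤ ∑ b : Bond d Pd, ‖A b‖ ^ 2 := Finset.sum_nonneg fun b _ => sq_nonneg _
  calc _ ≤ ∑ p : B9SectCLatticeCarrier.Plaq d Pd, 2 * K ^ 2 * (‖A (shift p.2.1.1 p.1, p.2.1.2)‖ ^ 2 + ‖A (shift p.2.1.2 p.1, p.2.1.1)‖ ^ 2) :=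
        Finset.sum_le_sum fun p _ => hpt p
    _ = 2 * K ^ 2 * ((∑ p : B9SectCLatticeCarrier.Plaq d Pd, ‖A (shift p.2.1.1 p.1, p.2.1.2)‖ ^ 2) + ∑ p : B9SectCLatticeCarrier.Plaq d Pd, ‖A (shift p.2.1.2 p.1, p.2.1.1)‖ ^ 2) := by
        rw [← Finset.sum_add_distrib, Finset.mul_sum]
    _ ≤ 2 * K ^ 2 * ((d : ℝ) ^ 2 * (∑ b : Bond d Pd, ‖A b‖ ^ 2) + (d : ℝ) ^ 2 * ∑ b : Bond d Pd, ‖A b‖ ^ 2) := by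
        gcongr 2 * K ^ 2 * (?_ + ?_)
        · exact hS1.trans (mul_le_mul_of_nonneg_right hN hsum0)
        · exact hS2.trans (mul_le_mul_of_nonneg_right hN hsum0)
    _ = 4 * K ^ 2 * (d : ℝ) ^ 2 * ∑ b : Bond d Pd, ‖A b‖ ^ 2 := by ring

end Curl

/-! ## §2 The divergence (3.8), function level -/

section Div

variable {d : ℕ} {Pd : Fin d → ℕ} {V : Type*} [NormedAddCommGroup V] [NormedSpace ℂ V]

/-- **IDENTITY (general weights)** for (3.8) `(D*A)(y) = c·Σ_μ (S(y−e_μ,μ)A(y−e_μ,μ) − A(y,μ))`: with `σ(y)ρ(y) = 1` the `A(y,μ)` terms cancel and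
`σ(y)(D*(ρA))(y) − (D*A)(y) = c·Σ_μ (σ(y)ρ(y−e_μ) − 1)·S(y−e_μ,μ)A(y−e_μ,μ)`. [folklore] [cite: Balaban1985BackgroundPropagators, (3.8) p.392, (3.101)–(3.103) p.414] -/
theorem conj_covDiv_sub_apply {σ ρ : TSite d Pd → ℂ} (hσρ : ∀ x, σ x * ρ x = 1) (c : ℂ) (S : Bond d Pd → V →ₗ[ℂ] V) (A : Bond d Pd → V)
    (y : TSite d Pd) :
    σ y • covDiv c S (fun b => ρ (bpos b) • A b) y - covDiv c S A y =
      c • ∑ μ, (σ y * ρ (unshift μ y) - 1) • S (unshift μ y, μ) (A (unshift μ y, μ)) := by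
  have h1 := hσρ y
  rw [covDiv_apply, covDiv_apply, smul_comm (σ y) c, ← smul_sub, Finset.smul_sum, ← Finset.sum_sub_distrib]
  congr 1
  refine Finset.sum_congr rfl fun μ _ => ?_
  simp only [bpos, map_smul, smul_sub, smul_smul]
  match_scalars <;> first | ring1 | linear_combination h1 | linear_combination (-1 : ℂ) * h1

/-- **POINTWISE BOUND** for (3.8): `‖(e^{κχ} D* e^{−κχ} − D*)A (y)‖ ≤ 2‖c‖‖κ‖θ·M_T·Σ_μ ‖A(y−e_μ,μ)‖` (increments `|χ(b₋) − χ(b₊)| ≤ θ`, window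
`‖κ‖θ ≤ 1`, `‖S(b)v‖ ≤ M_T‖v‖`). [folklore] [cite: Balaban1985BackgroundPropagators, (3.49) p.399, (3.101)–(3.103) p.414] -/
theorem norm_conjExp_covDiv_sub_apply_le {θ MT : ℝ} {S : Bond d Pd → V →ₗ[ℂ] V} (hS : ∀ b v, ‖S b v‖ ≤ MT * ‖v‖) {κ : ℂ}
    {χ : TSite d Pd → ℝ} (hχ : ∀ b : Bond d Pd, |χ (bpos b) - χ (btgt b)| ≤ θ) (hwin : ‖κ‖ * θ ≤ 1) (c : ℂ) (A : Bond d Pd → V)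
    (y : TSite d Pd) :
    ‖Complex.exp (κ * (χ y : ℂ)) • covDiv c S (fun b => Complex.exp (-(κ * (χ (bpos b) : ℂ))) • A b) y - covDiv c S A y‖ ≤
      2 * ‖c‖ * ‖κ‖ * θ * MT * ∑ μ, ‖A (unshift μ y, μ)‖ := by
  rw [conj_covDiv_sub_apply (exp_mul_exp_neg_eq_one κ χ) c S A y, norm_smul, Finset.mul_sum]
  have hterm : ∀ μ : Fin d, ‖(Complex.exp (κ * (χ y : ℂ)) * Complex.exp (-(κ * (χ (unshift μ y) : ℂ))) - 1) •
      S (unshift μ y, μ) (A (unshift μ y, μ))‖ ≤ 2 * ‖κ‖ * θ * MT * ‖A (unshift μ y, μ)‖ := fun μ => by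
    rw [exp_mul_exp_neg_eq_exp_sub, norm_smul]
    have hinc : |χ y - χ (unshift μ y)| ≤ θ := by
      rw [abs_sub_comm]
      have h := hχ (unshift μ y, μ)
      simp only [bpos, btgt, shift_unshift] at h
      exact h
    have h1 : ‖Complex.exp (κ * ((χ y - χ (unshift μ y) : ℝ) : ℂ)) - 1‖ ≤ 2 * ‖κ‖ * θ := norm_exp_sub_one_le_of_abs_le hinc hwin
    have h0 : 0 ≤ 2 * ‖κ‖ * θ := le_trans (norm_nonneg _) h1
    calc _ ≤ (2 * ‖κ‖ * θ) * (MT * ‖A (unshift μ y, μ)‖) := mul_le_mul h1 (hS _ _) (norm_nonneg _) h0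
      _ = 2 * ‖κ‖ * θ * MT * ‖A (unshift μ y, μ)‖ := by ring
  calc ‖c‖ * ‖∑ μ, (Complex.exp (κ * (χ y : ℂ)) * Complex.exp (-(κ * (χ (unshift μ y) : ℂ))) - 1) • S (unshift μ y, μ) (A (unshift μ y, μ))‖
      ≤ ‖c‖ * ∑ μ, 2 * ‖κ‖ * θ * MT * ‖A (unshift μ y, μ)‖ :=
        mul_le_mul_of_nonneg_left ((norm_sum_le _ _).trans (Finset.sum_le_sum fun μ _ => hterm μ)) (norm_nonneg c)
    _ = ∑ μ, 2 * ‖c‖ * ‖κ‖ * θ * MT * ‖A (unshift μ y, μ)‖ := by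
        rw [Finset.mul_sum]; exact Finset.sum_congr rfl fun μ _ => by ring

/-- COUNTING: `Σ_y Σ_μ g(y−e_μ, μ) = Σ_b g(b)` (each bond is `(y − e_μ, μ)` for exactly one site `y`, namely its tip). [folklore]
[cite: Balaban1985BackgroundPropagators, (3.8) p.392] -/
theorem sum_site_unshift_eq (g : Bond d Pd → ℝ) : ∑ y : TSite d Pd, ∑ μ, g (unshift μ y, μ) = ∑ b : Bond d Pd, g b := by
  calc ∑ y : TSite d Pd, ∑ μ, g (unshift μ y, μ) = ∑ μ : Fin d, ∑ y : TSite d Pd, g (unshift μ y, μ) := Finset.sum_comm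
    _ = ∑ μ : Fin d, ∑ x : TSite d Pd, g (x, μ) := Finset.sum_congr rfl fun μ _ =>
        Fintype.sum_equiv (shiftEquiv μ).symm (fun y => g (unshift μ y, μ)) (fun x => g (x, μ)) (fun y => rfl)
    _ = ∑ x : TSite d Pd, ∑ μ : Fin d, g (x, μ) := Finset.sum_comm
    _ = ∑ b : Bond d Pd, g b := by rw [Fintype.sum_prod_type]

/-- **`ℓ²` BOUND, function level:** `Σ_y ‖(e^{κχ} D* e^{−κχ} − D*)A (y)‖² ≤ (2‖c‖‖κ‖θM_T)²·d·Σ_b ‖A(b)‖²` (Cauchy–Schwarz over the `d` directions,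
then the bond count). [folklore] [cite: Balaban1985BackgroundPropagators, (3.49) p.399, (3.101)–(3.103) p.414] -/
theorem sum_norm_sq_conjExp_covDiv_sub_le {θ MT : ℝ} {S : Bond d Pd → V →ₗ[ℂ] V} (hS : ∀ b v, ‖S b v‖ ≤ MT * ‖v‖) {κ : ℂ}
    {χ : TSite d Pd → ℝ} (hχ : ∀ b : Bond d Pd, |χ (bpos b) - χ (btgt b)| ≤ θ) (hwin : ‖κ‖ * θ ≤ 1) (c : ℂ) (A : Bond d Pd → V) :
    ∑ y : TSite d Pd, ‖Complex.exp (κ * (χ y : ℂ)) • covDiv c S (fun b => Complex.exp (-(κ * (χ (bpos b) : ℂ))) • A b) y - covDiv c S A y‖ ^ 2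
      ≤ (2 * ‖c‖ * ‖κ‖ * θ * MT) ^ 2 * d * ∑ b : Bond d Pd, ‖A b‖ ^ 2 := by
  set K : ℝ := 2 * ‖c‖ * ‖κ‖ * θ * MT with hK
  have hpt : ∀ y : TSite d Pd, ‖Complex.exp (κ * (χ y : ℂ)) • covDiv c S (fun b => Complex.exp (-(κ * (χ (bpos b) : ℂ))) • A b) y -
      covDiv c S A y‖ ^ 2 ≤ K ^ 2 * (d * ∑ μ, ‖A (unshift μ y, μ)‖ ^ 2) := fun y => by
    have h := norm_conjExp_covDiv_sub_apply_le hS hχ hwin c A y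
    have h0 : 0 ≤ K * ∑ μ, ‖A (unshift μ y, μ)‖ := (norm_nonneg _).trans h
    have hcs : (∑ μ, ‖A (unshift μ y, μ)‖) ^ 2 ≤ d * ∑ μ, ‖A (unshift μ y, μ)‖ ^ 2 := by
      have h := sq_sum_le_card_mul_sum_sq (s := Finset.univ) (f := fun μ : Fin d => ‖A (unshift μ y, μ)‖)
      rwa [Finset.card_univ, Fintype.card_fin] at h
    calc _ ≤ (K * ∑ μ, ‖A (unshift μ y, μ)‖) ^ 2 := pow_le_pow_left₀ (norm_nonneg _) h 2
      _ = K ^ 2 * (∑ μ, ‖A (unshift μ y, μ)‖) ^ 2 := by ring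
      _ ≤ K ^ 2 * (d * ∑ μ, ‖A (unshift μ y, μ)‖ ^ 2) := mul_le_mul_of_nonneg_left hcs (sq_nonneg K)
  calc _ ≤ ∑ y : TSite d Pd, K ^ 2 * (d * ∑ μ, ‖A (unshift μ y, μ)‖ ^ 2) := Finset.sum_le_sum fun y _ => hpt y
    _ = K ^ 2 * d * ∑ y : TSite d Pd, ∑ μ, ‖A (unshift μ y, μ)‖ ^ 2 := by rw [mul_sum]; exact Finset.sum_congr rfl fun y _ => by ring
    _ = K ^ 2 * d * ∑ b : Bond d Pd, ‖A b‖ ^ 2 := by rw [sum_site_unshift_eq (fun b => ‖A b‖ ^ 2)]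

end Div

/-! ## §3 The letters on the weighted `L²` carriers (uniform weight `c₀` on sites, bonds and plaquettes) -/

section L2

variable {d : ℕ} {Pd : Fin d → ℕ} {V : Type*} [NormedAddCommGroup V] [InnerProductSpace ℂ V] {c₀ : ℝ} [Fact (0 < c₀)]

/-- **THE CURL LETTER IN `L²`:** `‖e^{κχ}·curl(e^{−κχ}A) − curl A‖ ≤ 4‖c‖‖κ‖θ·M_T·d·‖A‖` (`0 ≤ θ`, `0 ≤ M_T`, `‖κ‖θ ≤ 1`; conjugated field and
outside weight written through `WL2.equiv`). [folklore] [cite: Balaban1985BackgroundPropagators, (3.49) p.399, (3.101)–(3.103) p.414, (3.11) p.392] -/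
theorem norm_conjExp_covCurlL2K_sub_le {θ MT : ℝ} (hθ : 0 ≤ θ) (hMT : 0 ≤ MT) {R : Bond d Pd → V →ₗ[ℂ] V} (hR : ∀ b v, ‖R b v‖ ≤ MT * ‖v‖)
    {κ : ℂ} {χ : TSite d Pd → ℝ} (hχ : ∀ b : Bond d Pd, |χ (bpos b) - χ (btgt b)| ≤ θ) (hwin : ‖κ‖ * θ ≤ 1) (c : ℂ)
    (A : BondL2K ℂ d Pd c₀ V) :
    ‖(WL2.equiv ℂ (fun _ : B9SectCLatticeCarrier.Plaq d Pd => c₀) V).symm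
          (fun p => Complex.exp (κ * (χ p.1 : ℂ)) •
            WL2.equiv ℂ (fun _ : B9SectCLatticeCarrier.Plaq d Pd => c₀) V
              (covCurlL2K ℂ c₀ c R ((WL2.equiv ℂ (fun _ : Bond d Pd => c₀) V).symm
                fun b => Complex.exp (-(κ * (χ (bpos b) : ℂ))) • WL2.equiv ℂ (fun _ : Bond d Pd => c₀) V A b)) p) -
        covCurlL2K ℂ c₀ c R A‖ ≤ 4 * ‖c‖ * ‖κ‖ * θ * MT * d * ‖A‖ := by
  set K : ℝ := 2 * ‖c‖ * ‖κ‖ * θ * MT with hK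
  have hK0 : 0 ≤ K := by positivity
  have hc₀ : 0 < c₀ := Fact.out
  set B : Bond d Pd → V := WL2.equiv ℂ (fun _ : Bond d Pd => c₀) V A with hB
  have hsum := sum_norm_sq_conjExp_covCurl_sub_le hR hχ hwin c B
  have hsq : ‖(WL2.equiv ℂ (fun _ : B9SectCLatticeCarrier.Plaq d Pd => c₀) V).symm
          (fun p => Complex.exp (κ * (χ p.1 : ℂ)) •
            WL2.equiv ℂ (fun _ : B9SectCLatticeCarrier.Plaq d Pd => c₀) V
              (covCurlL2K ℂ c₀ c R ((WL2.equiv ℂ (fun _ : Bond d Pd => c₀) V).symm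
                fun b => Complex.exp (-(κ * (χ (bpos b) : ℂ))) • WL2.equiv ℂ (fun _ : Bond d Pd => c₀) V A b)) p) -
        covCurlL2K ℂ c₀ c R A‖ ^ 2 ≤ (2 * K * d * ‖A‖) ^ 2 := by
    rw [WL2.norm_sq, mul_pow, mul_pow, mul_pow, WL2.norm_sq A]
    have e : ∀ p : B9SectCLatticeCarrier.Plaq d Pd,
        WL2.equiv ℂ (fun _ : B9SectCLatticeCarrier.Plaq d Pd => c₀) V ((WL2.equiv ℂ (fun _ : B9SectCLatticeCarrier.Plaq d Pd => c₀) V).symm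
          (fun p => Complex.exp (κ * (χ p.1 : ℂ)) •
            WL2.equiv ℂ (fun _ : B9SectCLatticeCarrier.Plaq d Pd => c₀) V
              (covCurlL2K ℂ c₀ c R ((WL2.equiv ℂ (fun _ : Bond d Pd => c₀) V).symm
                fun b => Complex.exp (-(κ * (χ (bpos b) : ℂ))) • WL2.equiv ℂ (fun _ : Bond d Pd => c₀) V A b)) p) -
          covCurlL2K ℂ c₀ c R A) p =
        Complex.exp (κ * (χ p.1 : ℂ)) • covCurl c R (fun b => Complex.exp (-(κ * (χ (bpos b) : ℂ))) • B b) p - covCurl c R B p :=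
      fun p => rfl
    simp only [e]
    rw [← mul_sum, ← mul_sum]
    calc c₀ * ∑ p : B9SectCLatticeCarrier.Plaq d Pd, ‖Complex.exp (κ * (χ p.1 : ℂ)) • covCurl c R (fun b => Complex.exp (-(κ * (χ (bpos b) : ℂ))) • B b) p -
            covCurl c R B p‖ ^ 2
        ≤ c₀ * (4 * K ^ 2 * (d : ℝ) ^ 2 * ∑ b, ‖B b‖ ^ 2) := mul_le_mul_of_nonneg_left hsum hc₀.le
      _ = 2 ^ 2 * K ^ 2 * (d : ℝ) ^ 2 * (c₀ * ∑ b, ‖B b‖ ^ 2) := by ring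
  have hR0 : 0 ≤ 2 * K * d * ‖A‖ := by positivity
  calc _ ≤ 2 * K * d * ‖A‖ := (pow_le_pow_iff_left₀ (norm_nonneg _) hR0 two_ne_zero).1 hsq
    _ = 4 * ‖c‖ * ‖κ‖ * θ * MT * d * ‖A‖ := by rw [hK]; ring

/-- **THE DIVERGENCE LETTER IN `L²`:** `‖e^{κχ}·D*(e^{−κχ}A) − D*A‖ ≤ 2‖c‖‖κ‖θ·M_T·√d·‖A‖` (`0 ≤ θ`, `0 ≤ M_T`, `‖κ‖θ ≤ 1`). [folklore]
[cite: Balaban1985BackgroundPropagators, (3.49) p.399, (3.101)–(3.103) p.414, (3.11) p.392] -/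
theorem norm_conjExp_covDivL2K_sub_le {θ MT : ℝ} (hθ : 0 ≤ θ) (hMT : 0 ≤ MT) {S : Bond d Pd → V →ₗ[ℂ] V} (hS : ∀ b v, ‖S b v‖ ≤ MT * ‖v‖)
    {κ : ℂ} {χ : TSite d Pd → ℝ} (hχ : ∀ b : Bond d Pd, |χ (bpos b) - χ (btgt b)| ≤ θ) (hwin : ‖κ‖ * θ ≤ 1) (c : ℂ)
    (A : BondL2K ℂ d Pd c₀ V) :
    ‖(WL2.equiv ℂ (fun _ : TSite d Pd => c₀) V).symm
          (fun y => Complex.exp (κ * (χ y : ℂ)) •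
            WL2.equiv ℂ (fun _ : TSite d Pd => c₀) V
              (covDivL2K ℂ c₀ c S ((WL2.equiv ℂ (fun _ : Bond d Pd => c₀) V).symm
                fun b => Complex.exp (-(κ * (χ (bpos b) : ℂ))) • WL2.equiv ℂ (fun _ : Bond d Pd => c₀) V A b)) y) -
        covDivL2K ℂ c₀ c S A‖ ≤ 2 * ‖c‖ * ‖κ‖ * θ * MT * Real.sqrt d * ‖A‖ := by
  set K : ℝ := 2 * ‖c‖ * ‖κ‖ * θ * MT with hK
  have hK0 : 0 ≤ K := by positivity
  have hc₀ : 0 < c₀ := Fact.out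
  set B : Bond d Pd → V := WL2.equiv ℂ (fun _ : Bond d Pd => c₀) V A with hB
  have hsum := sum_norm_sq_conjExp_covDiv_sub_le hS hχ hwin c B
  have hsq : ‖(WL2.equiv ℂ (fun _ : TSite d Pd => c₀) V).symm
          (fun y => Complex.exp (κ * (χ y : ℂ)) •
            WL2.equiv ℂ (fun _ : TSite d Pd => c₀) V
              (covDivL2K ℂ c₀ c S ((WL2.equiv ℂ (fun _ : Bond d Pd => c₀) V).symm
                fun b => Complex.exp (-(κ * (χ (bpos b) : ℂ))) • WL2.equiv ℂ (fun _ : Bond d Pd => c₀) V A b)) y) -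
        covDivL2K ℂ c₀ c S A‖ ^ 2 ≤ (K * Real.sqrt d * ‖A‖) ^ 2 := by
    rw [WL2.norm_sq, mul_pow, mul_pow, Real.sq_sqrt (Nat.cast_nonneg d), WL2.norm_sq A]
    have e : ∀ y : TSite d Pd,
        WL2.equiv ℂ (fun _ : TSite d Pd => c₀) V ((WL2.equiv ℂ (fun _ : TSite d Pd => c₀) V).symm
          (fun y => Complex.exp (κ * (χ y : ℂ)) •
            WL2.equiv ℂ (fun _ : TSite d Pd => c₀) V
              (covDivL2K ℂ c₀ c S ((WL2.equiv ℂ (fun _ : Bond d Pd => c₀) V).symm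
                fun b => Complex.exp (-(κ * (χ (bpos b) : ℂ))) • WL2.equiv ℂ (fun _ : Bond d Pd => c₀) V A b)) y) -
          covDivL2K ℂ c₀ c S A) y =
        Complex.exp (κ * (χ y : ℂ)) • covDiv c S (fun b => Complex.exp (-(κ * (χ (bpos b) : ℂ))) • B b) y - covDiv c S B y :=
      fun y => rfl
    simp only [e]
    rw [← mul_sum, ← mul_sum]
    calc c₀ * ∑ y : TSite d Pd, ‖Complex.exp (κ * (χ y : ℂ)) • covDiv c S (fun b => Complex.exp (-(κ * (χ (bpos b) : ℂ))) • B b) y -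
            covDiv c S B y‖ ^ 2
        ≤ c₀ * (K ^ 2 * d * ∑ b, ‖B b‖ ^ 2) := mul_le_mul_of_nonneg_left hsum hc₀.le
      _ = K ^ 2 * d * (c₀ * ∑ b, ‖B b‖ ^ 2) := by ring
  have hR0 : 0 ≤ K * Real.sqrt d * ‖A‖ := by positivity
  calc _ ≤ K * Real.sqrt d * ‖A‖ := (pow_le_pow_iff_left₀ (norm_nonneg _) hR0 two_ne_zero).1 hsq
    _ = 2 * ‖c‖ * ‖κ‖ * θ * MT * Real.sqrt d * ‖A‖ := by rw [hK]

/-- **THE CURL LETTER FOR ABSTRACT MAPS** `S_P` (on plaquette fields, acting as `e^{κχ(p₀)}`) and `S_B⁻¹` (on bond fields, acting as `e^{−κχ(b₋)}`):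
`‖S_P(curl(S_B⁻¹A)) − curl A‖ ≤ 4‖c‖‖κ‖θ·M_T·d·‖A‖`. [folklore] [cite: Balaban1985BackgroundPropagators, (3.49) p.399, (3.101)–(3.103) p.414] -/
theorem norm_mulOp_covCurlL2K_sub_le {θ MT : ℝ} (hθ : 0 ≤ θ) (hMT : 0 ≤ MT) {R : Bond d Pd → V →ₗ[ℂ] V} (hR : ∀ b v, ‖R b v‖ ≤ MT * ‖v‖)
    {κ : ℂ} {χ : TSite d Pd → ℝ} (hχ : ∀ b : Bond d Pd, |χ (bpos b) - χ (btgt b)| ≤ θ) (hwin : ‖κ‖ * θ ≤ 1) (c : ℂ)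
    (SP : PlaqL2K ℂ d Pd c₀ V → PlaqL2K ℂ d Pd c₀ V)
    (hSP : ∀ (F : PlaqL2K ℂ d Pd c₀ V) (p : B9SectCLatticeCarrier.Plaq d Pd),
      WL2.equiv ℂ (fun _ : B9SectCLatticeCarrier.Plaq d Pd => c₀) V (SP F) p = Complex.exp (κ * (χ p.1 : ℂ)) • WL2.equiv ℂ (fun _ : B9SectCLatticeCarrier.Plaq d Pd => c₀) V F p)
    (SBinv : BondL2K ℂ d Pd c₀ V → BondL2K ℂ d Pd c₀ V)
    (hSBinv : ∀ (A : BondL2K ℂ d Pd c₀ V) (b : Bond d Pd),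
      WL2.equiv ℂ (fun _ : Bond d Pd => c₀) V (SBinv A) b = Complex.exp (-(κ * (χ (bpos b) : ℂ))) • WL2.equiv ℂ (fun _ : Bond d Pd => c₀) V A b)
    (A : BondL2K ℂ d Pd c₀ V) :
    ‖SP (covCurlL2K ℂ c₀ c R (SBinv A)) - covCurlL2K ℂ c₀ c R A‖ ≤ 4 * ‖c‖ * ‖κ‖ * θ * MT * d * ‖A‖ := by
  rw [eq_symm_of_pointwise SP _ hSP, eq_symm_of_pointwise SBinv _ hSBinv]
  exact norm_conjExp_covCurlL2K_sub_le hθ hMT hR hχ hwin c A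

/-- **THE DIVERGENCE LETTER FOR ABSTRACT MAPS** `S_S` (on site fields, `e^{κχ(y)}`) and `S_B⁻¹` (on bond fields, `e^{−κχ(b₋)}`):
`‖S_S(D*(S_B⁻¹A)) − D*A‖ ≤ 2‖c‖‖κ‖θ·M_T·√d·‖A‖`. [folklore] [cite: Balaban1985BackgroundPropagators, (3.49) p.399, (3.101)–(3.103) p.414] -/
theorem norm_mulOp_covDivL2K_sub_le {θ MT : ℝ} (hθ : 0 ≤ θ) (hMT : 0 ≤ MT) {S : Bond d Pd → V →ₗ[ℂ] V} (hS : ∀ b v, ‖S b v‖ ≤ MT * ‖v‖)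
    {κ : ℂ} {χ : TSite d Pd → ℝ} (hχ : ∀ b : Bond d Pd, |χ (bpos b) - χ (btgt b)| ≤ θ) (hwin : ‖κ‖ * θ ≤ 1) (c : ℂ)
    (SS : SiteL2K ℂ d Pd c₀ V → SiteL2K ℂ d Pd c₀ V)
    (hSS : ∀ (f : SiteL2K ℂ d Pd c₀ V) (y : TSite d Pd),
      WL2.equiv ℂ (fun _ : TSite d Pd => c₀) V (SS f) y = Complex.exp (κ * (χ y : ℂ)) • WL2.equiv ℂ (fun _ : TSite d Pd => c₀) V f y)
    (SBinv : BondL2K ℂ d Pd c₀ V → BondL2K ℂ d Pd c₀ V)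
    (hSBinv : ∀ (A : BondL2K ℂ d Pd c₀ V) (b : Bond d Pd),
      WL2.equiv ℂ (fun _ : Bond d Pd => c₀) V (SBinv A) b = Complex.exp (-(κ * (χ (bpos b) : ℂ))) • WL2.equiv ℂ (fun _ : Bond d Pd => c₀) V A b)
    (A : BondL2K ℂ d Pd c₀ V) :
    ‖SS (covDivL2K ℂ c₀ c S (SBinv A)) - covDivL2K ℂ c₀ c S A‖ ≤ 2 * ‖c‖ * ‖κ‖ * θ * MT * Real.sqrt d * ‖A‖ := by
  rw [eq_symm_of_pointwise SS _ hSS, eq_symm_of_pointwise SBinv _ hSBinv]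
  exact norm_conjExp_covDivL2K_sub_le hθ hMT hS hχ hwin c A

end L2

end Literature.MathematicalPhysics.QuantumFieldTheory.Balaban1983to89.B9Eq3101ConjugationLettersCurl

end
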